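import Summits.QuantumAdvantage.QuantumAdvantage.Theorems.WbwObfuscatedGluedTreesKowBbChain

/-!
# Line `knowledge-of-walk-split`, STAGE 5 (black-box soundness) — Theorem 9 at general name length from the two stubs
# (crux `WbwObfuscatedGluedTrees`, stmt-QuantumAdvantage-2340, route WhiteBoxWalk; lead c4)

Support file of the stage-5 skeleton: conjunct (ii) of `BlackBoxSoundness` — Childs et al. 2003 Theorem 9 at every
name length `N ≥ 2d` with a random entrance name, `findProbN d N M x t ≤ 4 · 2^{-d/6}` for `t ≤ 2^{d/6}` — from the
registered stubs `stub_simN` (simulation inside Game 1 along an injection `g : {0,1}^{2d} ↪ {0,1}^N`) and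
`stub_coupling` (the re-randomised naming `g ∘ ν` is uniform), taken as hypotheses, and `ChildsEtAl2003_thm9_holds`
averaged over `g` (`thm9N_of`).  Registered helper stub proved here: `toolkit_bbThm9N` (= `naming_nonempty`: Game-1
namings exist from depth 2 on). [cite: ChildsEtAl2003, §4 (Theorem 9)]
-/

set_option linter.dupNamespace false

noncomputable section

namespace Summit.QuantumAdvantage.QuantumAdvantage.Cruxes.WbwObfuscatedGluedTrees.KnowledgeOfWalkSplit.BlackBox

open Literature.Computability.Complexity Literature.Computability.QuantumComplexity
open Literature.Computability.QuantumComplexity.GluedTrees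
open Literature.Computability.Cryptography Literature.Computability.Cryptography.ObfuscatedGluedTrees
open Summit.QuantumAdvantage.QuantumAdvantage.Theorems.WbwObfuscatedGluedTrees.KnowledgeOfWalk.BlackBox

/-- `Game 1` namings exist from depth `2` on (`2^{n+2} − 2 ≤ 4^n` vertices, and a transposition fixes the entrance name). -/
theorem naming_nonempty {n : ℕ} (hn : 2 ≤ n) : Nonempty (Naming n) := by
  have hcard : Fintype.card (Vertex n) ≤ Fintype.card (Name n) := by
    rw [card_vertex, Fintype.card_fun, Fintype.card_bool, Fintype.card_fin]
    calc 2 ^ (n + 2) - 2 ≤ 2 ^ (n + 2) := Nat.sub_le _ _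
      _ ≤ 2 ^ (2 * n) := Nat.pow_le_pow_right (by norm_num) (by omega)
  obtain ⟨e⟩ := Function.Embedding.nonempty_of_card_le hcard
  refine ⟨⟨e.trans (Equiv.swap (e (entrance n)) (fun _ => false)).toEmbedding, ?_⟩⟩
  simp

/-! ## §3 Theorem 9 at general name length (conjunct (ii)) from `stub_simN` + `stub_coupling` -/

/-- **Conjunct (ii) from the two stubs**: re-randomise the `N`-bit naming as `g ∘ ν` (uniform by `stub_coupling`),
simulate by `stub_simN`, average Theorem 9 (`ChildsEtAl2003_thm9_holds`) over `g`. -/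
theorem thm9N_of (h₁ : Registered.stub_simN) (h₂ : Registered.stub_coupling) :
    ∀ (d N : ℕ) (β : Type) (M : OracleAlg β) (x : List Bool) (t : ℕ), 2 * d ≤ N →
      (t : ℝ) ≤ (2 : ℝ) ^ ((d : ℝ) / 6) → findProbN d N M x t ≤ 4 * (2 : ℝ) ^ (-((d : ℝ) / 6)) := by
  intro n N β M x t hN ht
  classical
  -- the trivial range `n ≤ 12`, where the bound is at least `1`
  by_cases hn12 : n ≤ 12
  · refine (findProbN_le_one n N M x t).trans ?_
    rw [Real.rpow_neg (by norm_num), ← div_eq_mul_inv, le_div_iff₀ (Real.rpow_pos_of_pos (by norm_num) _), one_mul]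
    calc (2 : ℝ) ^ ((n : ℝ) / 6) ≤ (2 : ℝ) ^ (2 : ℝ) := by
          apply Real.rpow_le_rpow_of_exponent_le (by norm_num)
          have : (n : ℝ) ≤ 12 := by exact_mod_cast hn12
          linarith
      _ = 4 := by rw [Real.rpow_two]; norm_num
  have hn1 : 1 ≤ n := by omega
  set b : ℝ := 4 * (2 : ℝ) ^ (-((n : ℝ) / 6)) with hb
  have hb0 : 0 ≤ b := by positivity
  -- the types of the coupling
  let G : Type := Name n ↪ (Fin N → Bool)
  haveI : Nonempty (Naming n) := naming_nonempty (by omega)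
  haveI : Nonempty G := by
    refine Function.Embedding.nonempty_of_card_le ?_
    simp only [Fintype.card_fun, Fintype.card_bool, Fintype.card_fin]
    exact Nat.pow_le_pow_right (by norm_num) hN
  -- the simulators, one per injection `g`
  choose Mg hMg using fun g : G => h₁ n N hn1 g M x
  -- Theorem 9 for each simulator, as a count
  have h9 : ∀ g : G, ((Finset.univ.filter (FindsExit (n := n) (Mg g) x t)).card : ℝ) ≤
      b * Fintype.card (Outcome n) := by
    intro g
    have h := ChildsEtAl2003_thm9_holds n (Mg g) x t ht
    unfold findProb at h
    have hO : (0 : ℝ) < Fintype.card (Outcome n) := by exact_mod_cast Fintype.card_pos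
    rwa [div_le_iff₀ hO] at h
  -- the coupling identity for the event `W = FindsExitN M x t`
  have hc := h₂ n N hN (FindsExitN (d := n) (N := N) M x t)
  -- pointwise simulation: `W (σ, g ∘ ν) → FindsExit (Mg g) (σ, ν)`
  have hsub : (Finset.univ.filter fun τ : CycleDatum n × Naming n × G =>
        FindsExitN M x t (τ.1, τ.2.1.1.trans τ.2.2)).card ≤
      (Finset.univ.filter fun τ : CycleDatum n × Naming n × G => FindsExit (Mg τ.2.2) x t (τ.1, τ.2.1)).card := by
    refine Finset.card_le_card fun τ hτ => ?_
    simp only [Finset.mem_filter, Finset.mem_univ, true_and] at hτ ⊢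
    exact hMg τ.2.2 t τ.1 τ.2.1 hτ
  -- slice the right-hand count along `g` and bound each slice by Theorem 9
  have hslice : ((Finset.univ.filter fun τ : CycleDatum n × Naming n × G =>
        FindsExit (Mg τ.2.2) x t (τ.1, τ.2.1)).card : ℝ) ≤ Fintype.card G * (b * Fintype.card (Outcome n)) := by
    rw [card_filter_prod₃ (fun (σ : CycleDatum n) (ν : Naming n) (g : G) => FindsExit (Mg g) x t (σ, ν))]
    push_cast
    calc (∑ g : G, ((Finset.univ.filter fun p : CycleDatum n × Naming n => FindsExit (Mg g) x t (p.1, p.2)).card : ℝ))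
        ≤ ∑ _g : G, b * Fintype.card (Outcome n) := Finset.sum_le_sum fun g _ => by
          convert h9 g using 4
      _ = Fintype.card G * (b * Fintype.card (Outcome n)) := by
          rw [Finset.sum_const, Finset.card_univ, nsmul_eq_mul]
  -- put everything together in `ℝ`
  have hcR : ((Finset.univ.filter (FindsExitN (d := n) (N := N) M x t)).card : ℝ) *
      (Fintype.card (Naming n) * Fintype.card G) ≤
      (Fintype.card G * (b * (Fintype.card (CycleDatum n) * Fintype.card (Naming n)))) * Fintype.card (NamingN n N) := by
    have := congrArg (fun m : ℕ => (m : ℝ)) hc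
    simp only [Nat.cast_mul, Fintype.card_prod] at this
    rw [this]
    have hO : (Fintype.card (Outcome n) : ℝ) = Fintype.card (CycleDatum n) * Fintype.card (Naming n) := by
      rw [Fintype.card_prod, Nat.cast_mul]
    rw [← hO]
    exact mul_le_mul_of_nonneg_right ((Nat.cast_le.mpr hsub).trans hslice) (Nat.cast_nonneg _)
  have hNm : (0 : ℝ) < Fintype.card (Naming n) := by exact_mod_cast Fintype.card_pos
  have hGc : (0 : ℝ) < Fintype.card G := by exact_mod_cast Fintype.card_pos
  have hkey : ((Finset.univ.filter (FindsExitN (d := n) (N := N) M x t)).card : ℝ) ≤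
      b * (Fintype.card (CycleDatum n) * Fintype.card (NamingN n N)) := by
    have := hcR
    rw [show (Fintype.card G : ℝ) * (b * (Fintype.card (CycleDatum n) * Fintype.card (Naming n))) *
        Fintype.card (NamingN n N) = (b * (Fintype.card (CycleDatum n) * Fintype.card (NamingN n N))) *
        (Fintype.card (Naming n) * Fintype.card G) by ring] at this
    exact le_of_mul_le_mul_right this (by positivity)
  unfold findProbN
  rcases Nat.eq_zero_or_pos (Fintype.card (OutcomeN n N)) with h0 | hpos
  · rw [h0]; simp [hb0]
  · rw [div_le_iff₀ (by exact_mod_cast hpos)]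
    calc ((Finset.univ.filter (FindsExitN (d := n) (N := N) M x t)).card : ℝ)
        ≤ b * (Fintype.card (CycleDatum n) * Fintype.card (NamingN n N)) := hkey
      _ = b * Fintype.card (OutcomeN n N) := by rw [← Nat.cast_mul, ← Fintype.card_prod]

/-- Registered helper stub of crux stmt-QuantumAdvantage-2340 (`toolkit_bbThm9N`, so that this support file lands
`--supports`): Game-1 namings exist from depth `2` on. [folklore] -/
theorem toolkit_bbThm9N : ∀ {n : ℕ}, 2 ≤ n → Nonempty (Naming n) :=
  fun hn => naming_nonempty hn

end Summit.QuantumAdvantage.QuantumAdvantage.Cruxes.WbwObfuscatedGluedTrees.KnowledgeOfWalkSplit.BlackBox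

end
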